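import Summits.HodgeConjecture.CorCM.Census.QuarticTwistResidual

/-!
# The quartic twist `(ℤ/4 × B, (2,0))`, V: the RESIDUAL STRUCTURE THEOREM — the elimination

COR-CM (cell `pub-hodgecm2`), count-neutral kernel combinatorics by the binder seat b09 (gen 32; lane QUARTIC-TWIST), sequel of
`Census/QuarticTwistResidual.lean` (its §3).  Theorems only; no `decide` table, no certificate, no named fact, no geometry, no `sorry`.
HONEST FRAMING: `HC_CM` is NOT proved; nothing here is a headline or a period.

**`residual_mem`** (`|B| ≥ 3`): every Hodge vector supported on the small residual types `u`, `u ± δ_b` lies in any submodule containing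
the pairs, the Boolean pair differences `X_{u,b}` and the Weil vectors `w_u` of `Census/QuarticTwistResidual.lean`.  PROOF: explicit
elimination — STEP A kills the `(+1)`-atoms with the `X`'s; STEP B the `(−1)`-atoms of regimes `2, 3` with pairs; STEP C the `(−1)`-atoms of
regimes `0, 1` at a base column `b₀` with `w_0, w_1`; STEP D: the form differences `F_{a,t} − F_{a,b₀}` (`form_diff`) force the remaining
`(−1)`-atoms to vanish; STEP E: a Hodge vector on the constant types is a sum of pairs (`mem_pairs_of_cst`).  All [folklore].

## References
* [Pohlmann1968] H. Pohlmann, Algebraic cycles on abelian varieties of complex multiplication type, Ann. of Math. 88 (1968), Thm 1.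
-/

namespace Summit.HodgeConjecture.CorCM.Census.QuarticTwist

open Finset

variable (B : Type) [AddGroup B] [Fintype B] [DecidableEq B]

/-! ## §3 The structure theorem -/

omit [AddGroup B] [Fintype B] in
/-- Support bookkeeping: subtracting a multiple of a vector supported on small residual types keeps the support small. [folklore] -/
theorem isRes1_support_sub {r v : Ty B → ℤ} (hr : ∀ s, r s ≠ 0 → IsRes1 B s) (hv : ∀ s, v s ≠ 0 → IsRes1 B s) (c : ℤ) :
    ∀ s, (r - c • v) s ≠ 0 → IsRes1 B s := by
  intro s hs
  rw [Pi.sub_apply, Pi.smul_apply, smul_eq_mul] at hs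
  by_cases h : r s = 0
  · rw [h, zero_sub, neg_ne_zero] at hs
    exact hv s (fun h' => hs (by rw [h', mul_zero]))
  · exact hr s h

omit [AddGroup B] in
/-- Support of a unit vector at an atom with `k ∈ {0, ±1}`. [folklore] -/
theorem isRes1_support_single (u : ZMod 4) (b : B) (k : ZMod 4) (hk : k = 0 ∨ k = 1 ∨ k = -1) (c : ℤ) :
    ∀ s, (Pi.single (atom B u b k) c : Ty B → ℤ) s ≠ 0 → IsRes1 B s := by
  intro s hs
  rw [Pi.single_apply] at hs
  by_cases h : s = atom B u b k
  · exact ⟨u, b, k, hk, h⟩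
  · rw [if_neg h] at hs; exact (hs rfl).elim

omit [AddGroup B] [Fintype B] in
/-- Support bookkeeping for sums. [folklore] -/
theorem isRes1_support_add {v w : Ty B → ℤ} (hv : ∀ s, v s ≠ 0 → IsRes1 B s) (hw : ∀ s, w s ≠ 0 → IsRes1 B s) :
    ∀ s, (v + w) s ≠ 0 → IsRes1 B s := by
  intro s hs
  rw [Pi.add_apply] at hs
  by_cases h : v s = 0
  · rw [h, zero_add] at hs; exact hw s hs
  · exact hv s h

omit [AddGroup B] [Fintype B] in
/-- Support bookkeeping for negation/subtraction of two small-supported vectors. [folklore] -/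
theorem isRes1_support_sub' {v w : Ty B → ℤ} (hv : ∀ s, v s ≠ 0 → IsRes1 B s) (hw : ∀ s, w s ≠ 0 → IsRes1 B s) :
    ∀ s, (v - w) s ≠ 0 → IsRes1 B s := by
  have := isRes1_support_sub B hv hw 1
  simpa only [one_smul] using this

omit [AddGroup B] in
/-- **THE RESIDUAL STRUCTURE THEOREM** (`|B| ≥ 3`).  A Hodge vector supported on the small residual types `u`, `u ± δ_b` lies in every
submodule containing the pairs, the Boolean pair differences `X_{u,b}` and the Weil vectors `w_u`. [folklore] -/
theorem residual_mem (h3 : 3 ≤ Fintype.card B) {N : Submodule ℤ (Ty B → ℤ)} (hP : pairs B ≤ N) (hX : ∀ (u : ZMod 4) (b : B), Xvec B u b ∈ N)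
    (hW : ∀ u : ZMod 4, Wvec B u ∈ N) {r : Ty B → ℤ} (hr : r ∈ hodge B) (hsupp : ∀ s, r s ≠ 0 → IsRes1 B s) : r ∈ N := by
  classical
  have hN : N ≤ hodge B → True := fun _ => trivial
  obtain ⟨b₀⟩ : Nonempty B := Fintype.card_pos_iff.mp (by omega)
  have h1 : (1 : ZMod 4) ≠ 0 := by decide
  have hm1 : (-1 : ZMod 4) ≠ 0 := by decide
  have hm11 : (-1 : ZMod 4) ≠ 1 := by decide
  have z4 : ((0 : ZMod 4) ≠ 1 ∧ (0 : ZMod 4) ≠ 2 ∧ (0 : ZMod 4) ≠ 3 ∧ (1 : ZMod 4) ≠ 0 ∧ (1 : ZMod 4) ≠ 2 ∧ (1 : ZMod 4) ≠ 3) ∧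
      ((2 : ZMod 4) ≠ 0 ∧ (2 : ZMod 4) ≠ 1 ∧ (2 : ZMod 4) ≠ 3 ∧ (3 : ZMod 4) ≠ 0 ∧ (3 : ZMod 4) ≠ 1 ∧ (3 : ZMod 4) ≠ 2) := by decide
  -- generic step: subtracting an element of `N ∩ H` keeps `r ∈ H` and the goal
  have step : ∀ {r v : Ty B → ℤ}, v ∈ N → v ∈ hodge B → (r - v ∈ N → r ∈ N) ∧ (r ∈ hodge B → r - v ∈ hodge B) :=
    fun hv hvH => ⟨fun h => by simpa using Submodule.add_mem _ h hv, fun h => Submodule.sub_mem _ h hvH⟩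
  -- STEP A: kill the `(+1)`-atoms with the `X`'s
  set vA : Ty B → ℤ := ∑ u : ZMod 4, ∑ b : B, r (atom B u b 1) • Xvec B u b with hvA
  have hvA_N : vA ∈ N := Submodule.sum_mem _ fun u _ => Submodule.sum_mem _ fun b _ => Submodule.smul_mem _ _ (hX u b)
  have hvA_H : vA ∈ hodge B := Submodule.sum_mem _ fun u _ => Submodule.sum_mem _ fun b _ => Submodule.smul_mem _ _ (Xvec_mem B u b)
  set r₁ := r - vA with hr₁
  have hX_apply_plus : ∀ (u : ZMod 4) (b : B) (u' : ZMod 4) (b' : B),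
      Xvec B u b (atom B u' b' 1) = if u = u' ∧ b = b' then 1 else 0 := by
    intro u b u' b'
    unfold Xvec
    rw [Pi.sub_apply, Pi.sub_apply, Pi.add_apply, single_atom_apply_atom B h3 h1, single_atom_apply_atom B h3 hm1,
      single_cst_apply_atom B h3 _ _ h1, single_cst_apply_atom B h3 _ _ h1]
    simp only [hm11, and_false, if_false, add_zero, sub_zero, and_true]
  have hX_apply_minus : ∀ (u : ZMod 4) (b : B) (u' : ZMod 4) (b' : B),
      Xvec B u b (atom B u' b' (-1)) = if u + 1 = u' ∧ b = b' then 1 else 0 := by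
    intro u b u' b'
    unfold Xvec
    rw [Pi.sub_apply, Pi.sub_apply, Pi.add_apply, single_atom_apply_atom B h3 h1, single_atom_apply_atom B h3 hm1,
      single_cst_apply_atom B h3 _ _ hm1, single_cst_apply_atom B h3 _ _ hm1]
    simp only [hm11.symm, and_false, if_false, zero_add, sub_zero, and_true]
  have hX_supp : ∀ (u : ZMod 4) (b : B), ∀ s, Xvec B u b s ≠ 0 → IsRes1 B s := by
    intro u b
    unfold Xvec
    refine isRes1_support_sub' B (isRes1_support_sub' B (isRes1_support_add B
      (isRes1_support_single B u b 1 (Or.inr (Or.inl rfl)) 1) (isRes1_support_single B (u+1) b (-1) (Or.inr (Or.inr rfl)) 1)) ?_) ?_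
    · rw [← atom_zero B u b]; exact isRes1_support_single B u b 0 (Or.inl rfl) 1
    · rw [← atom_zero B (u+1) b]; exact isRes1_support_single B (u+1) b 0 (Or.inl rfl) 1
  have hvA_apply_plus : ∀ (u' : ZMod 4) (b' : B), vA (atom B u' b' 1) = r (atom B u' b' 1) := by
    intro u' b'
    simp only [hvA, Finset.sum_apply, Pi.smul_apply, hX_apply_plus, smul_eq_mul, mul_ite, mul_one, mul_zero]
    rw [Finset.sum_eq_single_of_mem u' (mem_univ _) (fun u _ hu => Finset.sum_eq_zero (fun b _ => if_neg (fun h => hu h.1)))]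
    simp only [true_and]
    rw [Finset.sum_ite_eq', if_pos (mem_univ _)]
  have hr₁H : r₁ ∈ hodge B := (step hvA_N hvA_H).2 hr
  have hr₁plus : ∀ (u : ZMod 4) (b : B), r₁ (atom B u b 1) = 0 := by
    intro u b; rw [hr₁, Pi.sub_apply, hvA_apply_plus, sub_self]
  have hvA_supp : ∀ s, vA s ≠ 0 → IsRes1 B s := by
    rw [hvA]
    intro s hs
    obtain ⟨u, -, hu⟩ := Finset.exists_ne_zero_of_sum_ne_zero (by rwa [Finset.sum_apply] at hs)
    obtain ⟨b, -, hb⟩ := Finset.exists_ne_zero_of_sum_ne_zero (by rwa [Finset.sum_apply] at hu)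
    rw [Pi.smul_apply, smul_eq_mul] at hb
    exact hX_supp u b s (fun h => hb (by rw [h, mul_zero]))
  have hr₁supp : ∀ s, r₁ s ≠ 0 → IsRes1 B s := isRes1_support_sub' B hsupp hvA_supp
  refine (step hvA_N hvA_H).1 ?_
  show r₁ ∈ N
  -- now `r₁ ∈ H`, small support, no `(+1)`-atoms; it remains to show `r₁ ∈ N`
  clear_value r₁
  clear hvA_apply_plus hvA_supp hr hsupp hvA_N hvA_H hvA
  -- STEP B: kill the `(−1)`-atoms of regimes `2, 3` with pairs (`e_{(u+2)−δ_b} = pair − e_{u−δ_b}`)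
  set vB : Ty B → ℤ := ∑ b : B, (r₁ (atom B 2 b (-1)) • pairVec B (atom B 0 b (-1)) + r₁ (atom B 3 b (-1)) • pairVec B (atom B 1 b (-1)))
    with hvB
  have hpv : ∀ (u : ZMod 4) (b : B), pairVec B (atom B u b (-1)) = Pi.single (atom B u b (-1)) 1 + Pi.single (atom B (u + 2) b (-1)) 1 := by
    intro u b; unfold pairVec; rw [atom_add_two]
  have hvB_N : vB ∈ N := Submodule.sum_mem _ fun b _ => Submodule.add_mem _
    (Submodule.smul_mem _ _ (hP (pairVec_mem_pairs B _))) (Submodule.smul_mem _ _ (hP (pairVec_mem_pairs B _)))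
  have hvB_H : vB ∈ hodge B := Submodule.sum_mem _ fun b _ => Submodule.add_mem _
    (Submodule.smul_mem _ _ (pairVec_mem B _)) (Submodule.smul_mem _ _ (pairVec_mem B _))
  have hvB_apply : ∀ (u' : ZMod 4) (b' : B) (k' : ZMod 4), k' ≠ 0 → vB (atom B u' b' k') =
      (if (2 : ZMod 4) = u' ∧ (-1 : ZMod 4) = k' then r₁ (atom B 2 b' (-1)) else 0)
        + (if (3 : ZMod 4) = u' ∧ (-1 : ZMod 4) = k' then r₁ (atom B 3 b' (-1)) else 0)
        + (if (0 : ZMod 4) = u' ∧ (-1 : ZMod 4) = k' then r₁ (atom B 2 b' (-1)) else 0)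
        + (if (1 : ZMod 4) = u' ∧ (-1 : ZMod 4) = k' then r₁ (atom B 3 b' (-1)) else 0) := by
    intro u' b' k' hk'
    simp only [hvB, hpv, Finset.sum_apply, Pi.add_apply, Pi.smul_apply, single_atom_apply_atom B h3 hm1, smul_eq_mul,
      show (0 : ZMod 4) + 2 = 2 by decide, show (1 : ZMod 4) + 2 = 3 by decide]
    have hsplit : ∀ b : B, (r₁ (atom B 2 b (-1)) * ((if (0 : ZMod 4) = u' ∧ b = b' ∧ (-1 : ZMod 4) = k' then (1 : ℤ) else 0)
        + (if (2 : ZMod 4) = u' ∧ b = b' ∧ (-1 : ZMod 4) = k' then (1 : ℤ) else 0))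
        + r₁ (atom B 3 b (-1)) * ((if (1 : ZMod 4) = u' ∧ b = b' ∧ (-1 : ZMod 4) = k' then (1 : ℤ) else 0)
        + (if (3 : ZMod 4) = u' ∧ b = b' ∧ (-1 : ZMod 4) = k' then (1 : ℤ) else 0)))
        = if b = b' then ((if (2 : ZMod 4) = u' ∧ (-1 : ZMod 4) = k' then r₁ (atom B 2 b' (-1)) else 0)
          + (if (3 : ZMod 4) = u' ∧ (-1 : ZMod 4) = k' then r₁ (atom B 3 b' (-1)) else 0)
          + (if (0 : ZMod 4) = u' ∧ (-1 : ZMod 4) = k' then r₁ (atom B 2 b' (-1)) else 0)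
          + (if (1 : ZMod 4) = u' ∧ (-1 : ZMod 4) = k' then r₁ (atom B 3 b' (-1)) else 0)) else 0 := by
      intro b
      by_cases hb : b = b'
      · subst hb; simp only [true_and, if_true]; split_ifs <;> ring
      · simp only [hb, false_and, and_false, if_false]; ring
    rw [Finset.sum_congr rfl (fun b _ => hsplit b), Finset.sum_ite_eq', if_pos (mem_univ b')]
  set r₂ := r₁ - vB with hr₂
  have hr₂H : r₂ ∈ hodge B := (step hvB_N hvB_H).2 hr₁H
  have hr₂plus : ∀ (u : ZMod 4) (b : B), r₂ (atom B u b 1) = 0 := by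
    intro u b
    rw [hr₂, Pi.sub_apply, hr₁plus, hvB_apply _ _ _ h1]
    simp only [hm11, and_false, if_false, add_zero, sub_zero]
  have hr₂23 : ∀ b : B, r₂ (atom B 2 b (-1)) = 0 ∧ r₂ (atom B 3 b (-1)) = 0 := by
    intro b
    rw [hr₂, Pi.sub_apply, Pi.sub_apply, hvB_apply _ _ _ hm1, hvB_apply _ _ _ hm1]
    refine ⟨?_, ?_⟩ <;> simp [z4]
  have hvB_supp : ∀ s, vB s ≠ 0 → IsRes1 B s := by
    rw [hvB]
    intro s hs
    obtain ⟨b, -, hb⟩ := Finset.exists_ne_zero_of_sum_ne_zero (by rwa [Finset.sum_apply] at hs)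
    have hpsupp : ∀ (u : ZMod 4), ∀ s, pairVec B (atom B u b (-1)) s ≠ 0 → IsRes1 B s := fun u => by
      rw [hpv]
      exact isRes1_support_add B (isRes1_support_single B _ _ _ (Or.inr (Or.inr rfl)) 1)
        (isRes1_support_single B _ _ _ (Or.inr (Or.inr rfl)) 1)
    rw [Pi.add_apply] at hb
    by_cases h2 : (r₁ (atom B 2 b (-1)) • pairVec B (atom B 0 b (-1))) s = 0
    · rw [h2, zero_add, Pi.smul_apply, smul_eq_mul] at hb
      exact hpsupp 1 s (fun h => hb (by rw [h, mul_zero]))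
    · rw [Pi.smul_apply, smul_eq_mul] at h2
      exact hpsupp 0 s (fun h => h2 (by rw [h, mul_zero]))
  have hr₂supp : ∀ s, r₂ s ≠ 0 → IsRes1 B s := isRes1_support_sub' B hr₁supp hvB_supp
  refine (step hvB_N hvB_H).1 ?_
  show r₂ ∈ N
  clear_value r₂
  clear hvB_apply hvB_supp hvB_N hvB_H hvB hr₁H hr₁plus hr₁supp
  -- STEP C: kill the `(−1)`-atoms of regimes `0, 1` at the base column `b₀` with `w_0`, `w_1`
  set vC : Ty B → ℤ := r₂ (atom B 0 b₀ (-1)) • Wvec B 0 + r₂ (atom B 1 b₀ (-1)) • Wvec B 1 with hvC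
  have hvC_N : vC ∈ N := Submodule.add_mem _ (Submodule.smul_mem _ _ (hW 0)) (Submodule.smul_mem _ _ (hW 1))
  have hvC_H : vC ∈ hodge B := Submodule.add_mem _ (Submodule.smul_mem _ _ (Wvec_mem B 0)) (Submodule.smul_mem _ _ (Wvec_mem B 1))
  have hW_apply : ∀ (u u' : ZMod 4) (b' : B) (k' : ZMod 4), k' ≠ 0 →
      Wvec B u (atom B u' b' k') = if u = u' ∧ (-1 : ZMod 4) = k' then 1 else 0 := by
    intro u u' b' k' hk'
    unfold Wvec
    rw [Pi.sub_apply, Pi.sub_apply, Pi.smul_apply, single_cst_apply_atom B h3 _ _ hk', single_cst_apply_atom B h3 _ _ hk',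
      smul_zero, sub_zero, sub_zero, Finset.sum_apply]
    simp only [single_atom_apply_atom B h3 hm1]
    have : ∀ b : B, (if u = u' ∧ b = b' ∧ (-1 : ZMod 4) = k' then (1 : ℤ) else 0) = if b = b' then (if u = u' ∧ (-1 : ZMod 4) = k' then 1 else 0) else 0 := by
      intro b; by_cases hb : b = b' <;> simp [hb]
    rw [Finset.sum_congr rfl (fun b _ => this b), Finset.sum_ite_eq', if_pos (mem_univ b')]
  have hW_supp : ∀ (u : ZMod 4), ∀ s, Wvec B u s ≠ 0 → IsRes1 B s := by
    intro u s hs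
    unfold Wvec at hs
    rw [Pi.sub_apply, Pi.sub_apply] at hs
    by_cases ha : (∑ b, (Pi.single (atom B u b (-1)) (1 : ℤ) : Ty B → ℤ)) s = 0
    · rw [ha, zero_sub] at hs
      by_cases hb : (((Fintype.card B : ℤ) - 1) • (Pi.single (cst B u) (1 : ℤ) : Ty B → ℤ)) s = 0
      · rw [hb, neg_zero, zero_sub, neg_ne_zero] at hs
        rw [← atom_zero B (u - 1) b₀] at hs
        exact isRes1_support_single B _ _ _ (Or.inl rfl) 1 s hs
      · rw [Pi.smul_apply, smul_eq_mul, ← atom_zero B u b₀] at hb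
        exact isRes1_support_single B _ _ _ (Or.inl rfl) 1 s (fun h => hb (by rw [h, mul_zero]))
    · obtain ⟨b, -, hb⟩ := Finset.exists_ne_zero_of_sum_ne_zero (by rwa [Finset.sum_apply] at ha)
      exact isRes1_support_single B _ _ _ (Or.inr (Or.inr rfl)) 1 s hb
  set r₃ := r₂ - vC with hr₃
  have hr₃H : r₃ ∈ hodge B := (step hvC_N hvC_H).2 hr₂H
  have hvC_apply : ∀ (u' : ZMod 4) (b' : B) (k' : ZMod 4), k' ≠ 0 → vC (atom B u' b' k') =
      r₂ (atom B 0 b₀ (-1)) * (if (0 : ZMod 4) = u' ∧ (-1 : ZMod 4) = k' then 1 else 0)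
        + r₂ (atom B 1 b₀ (-1)) * (if (1 : ZMod 4) = u' ∧ (-1 : ZMod 4) = k' then 1 else 0) := by
    intro u' b' k' hk'
    rw [hvC, Pi.add_apply, Pi.smul_apply, Pi.smul_apply, hW_apply _ _ _ _ hk', hW_apply _ _ _ _ hk', smul_eq_mul, smul_eq_mul]
  have hr₃plus : ∀ (u : ZMod 4) (b : B), r₃ (atom B u b 1) = 0 := by
    intro u b
    rw [hr₃, Pi.sub_apply, hr₂plus, hvC_apply _ _ _ h1]
    simp only [hm11, and_false, if_false, mul_zero, add_zero, sub_zero]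
  have hr₃23 : ∀ b : B, r₃ (atom B 2 b (-1)) = 0 ∧ r₃ (atom B 3 b (-1)) = 0 := by
    intro b
    rw [hr₃, Pi.sub_apply, Pi.sub_apply, (hr₂23 b).1, (hr₂23 b).2, hvC_apply _ _ _ hm1, hvC_apply _ _ _ hm1]
    refine ⟨?_, ?_⟩ <;> simp [z4]
  have hr₃base : r₃ (atom B 0 b₀ (-1)) = 0 ∧ r₃ (atom B 1 b₀ (-1)) = 0 := by
    rw [hr₃, Pi.sub_apply, Pi.sub_apply, hvC_apply _ _ _ hm1, hvC_apply _ _ _ hm1]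
    refine ⟨?_, ?_⟩ <;> simp [z4]
  have hvC_supp : ∀ s, vC s ≠ 0 → IsRes1 B s := by
    rw [hvC]
    refine isRes1_support_add B ?_ ?_
    · intro s hs; rw [Pi.smul_apply, smul_eq_mul] at hs; exact hW_supp 0 s (fun h => hs (by rw [h, mul_zero]))
    · intro s hs; rw [Pi.smul_apply, smul_eq_mul] at hs; exact hW_supp 1 s (fun h => hs (by rw [h, mul_zero]))
  have hr₃supp : ∀ s, r₃ s ≠ 0 → IsRes1 B s := isRes1_support_sub' B hr₂supp hvC_supp
  refine (step hvC_N hvC_H).1 ?_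
  show r₃ ∈ N
  clear_value r₃
  clear hvC_apply hvC_supp hvC_N hvC_H hvC hr₂H hr₂plus hr₂23 hr₂supp
  -- STEP D: the remaining `(−1)`-atoms vanish by the form differences against the base column
  have hr₃minus : ∀ (u : ZMod 4) (t : B), r₃ (atom B u t (-1)) = 0 := by
    have h01 : ∀ t : B, r₃ (atom B 0 t (-1)) = 0 ∧ r₃ (atom B 1 t (-1)) = 0 := by
      intro t
      by_cases ht : t = b₀
      · rw [ht]; exact hr₃base
      · have d0 := form_diff B h3 hr₃supp hr₃plus 0 ht
        have d1 := form_diff B h3 hr₃supp hr₃plus 1 ht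
        rw [hr₃H (0, t), hr₃H (0, b₀), sub_self] at d0
        rw [hr₃H (1, t), hr₃H (1, b₀), sub_self] at d1
        simp only [show (0 : ZMod 4) + 1 = 1 by decide, show (0 : ZMod 4) - 1 = 3 by decide, show (1 : ZMod 4) + 1 = 2 by decide,
          show (1 : ZMod 4) - 1 = 0 by decide, hr₃base.1, hr₃base.2, (hr₃23 t).1, (hr₃23 t).2, (hr₃23 b₀).1, (hr₃23 b₀).2] at d0 d1
        constructor <;> linarith
    intro u t
    have key : ∀ u : ZMod 4, u = 0 ∨ u = 1 ∨ u = 2 ∨ u = 3 := by decide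
    rcases key u with rfl | rfl | rfl | rfl
    · exact (h01 t).1
    · exact (h01 t).2
    · exact (hr₃23 t).1
    · exact (hr₃23 t).2
  -- STEP E: `r₃` is supported on the constant types, hence a sum of pairs
  refine hP (mem_pairs_of_cst B b₀ hr₃H ?_)
  intro s hs
  obtain ⟨u, b, k, hk, rfl⟩ := hr₃supp s hs
  rcases hk with rfl | rfl | rfl
  · exact ⟨u, atom_zero B u b⟩
  · exact (hs (hr₃plus u b)).elim
  · exact (hs (hr₃minus u b)).elim

end Summit.HodgeConjecture.CorCM.Census.QuarticTwist
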